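import Literature.Geometry.Symplectic.SymplecticHomologicalOrientation
import Literature.Geometry.Symplectic.SymplecticSurfaceNonTorsion
import Literature.Geometry.Manifold.DeRhamFundamentalClassPairing
import HarnessLib

/-!
# The symplectic area functional; symplectic surfaces have non-zero area and are oriented by it

Topic `Literature/Geometry/Symplectic`. C. H. Taubes, *The Seiberg–Witten and Gromov invariants*,
Math. Res. Lett. 2 (1995) 221–238, §3 (p. 228): "The restriction of the symplectic form `ω` to a
pseudo-holomorphic submanifold `Σ` is always symplectic, and so orients `Σ`. With this orientation
understood, then `Σ` has a fundamental class which is a priori nontrivial in `H₂(X; ℤ)`. (This is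
because the integral of `ω` over `Σ` is positive.)"; D. McDuff, D. Salamon, *Introduction to
Symplectic Topology* (3rd ed. 2017), Ex. 4.4.5 and the proof of Thm. 13.3.11 (`∫_Σ ω > 0`, so a
symplectic surface represents a non-torsion class), proof of Cor. 13.3.24 (iii)
("`K · [ω] = ∫_C ω`").

This file names the functional `z ↦ ⟨[α], z ⊗ 1⟩` on `H_k(N; ℤ)` of a closed `k`-form `α` — its
PERIODS; for the symplectic form, the SYMPLECTIC AREA `⟨[ω], ·⟩` — over the tree's vocabulary
(`realClassOfClosedForm`, the image of the de Rham class under the integration isomorphism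
`integrationDeRhamIsoFamily`; `singularHomology.coeffChange ℤ → ℝ`; `kroneckerPairing`), and proves
what the statement of Taubes's theorem uses of it:

* `periodFunctional α hα hcl : H_k(N; ℤ) →+ ℝ` and the same map as a `ℤ`-linear map
  `periodLinearMap` (the shape of the additive area functional `A` of conjunct (iii) of
  `taubes_canonicalClass_symplecticCurve_four`);
* `periodFunctional_map_fundamentalClass` — NATURALITY: for a `C^∞` map `f : S → N` from a closed
  oriented `k`-manifold, `⟨[α], f_*[S] ⊗ 1⟩ = ⟨[f^* α], [S] ⊗ 1⟩` (Lee 2013, Thm. 18.14, through the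
  tree's `integrationDeRhamIsoFamily_map_of_contMDiff` and `kroneckerPairing_map`);
* `periodFunctional_map_fundamentalClass_ne_zero` — if `f^* α` vanishes nowhere on the closed
  connected `S`, the period on `f_*[S]` is non-zero for EVERY `ℤ`-orientation of `S` (the tree's
  `kroneckerPairing_integrationDeRham_map_fundamentalClass_ne_zero`: a nowhere-vanishing top form
  is not exact), it changes sign with the orientation (`periodFunctional_map_fundamentalClass_neg`),
  so EXACTLY ONE orientation of `S` makes it positive
  (`exists_periodFunctional_map_fundamentalClass_pos`, `eq_of_periodFunctional_map_fundamentalClass_pos`)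
  — the orientation of `S` induced by `α`, characterised without any choice of generator of local
  homology (cf. the module docstring of `SymplecticHomologicalOrientation.lean`: the tree's
  constructive `surfaceOrientation` / `symplecticSurfaceOrientation` are the book's orientation only
  up to an undecidable sign, whereas positivity of the period pins the orientation);
* the symplectic case `n = 4`, `k = 2`: a surface on which the `2`-form `s` is non-degenerate has
  non-zero symplectic area for every orientation (`periodFunctional_map_ne_zero_of_symplecticSurface`,
  Taubes loc. cit., McDuff–Salamon Ex. 4.4.5), positive for exactly one
  (`exists_periodFunctional_map_pos_of_symplecticSurface`, `…_of_isSmoothEmbedding`,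
  `eq_of_periodFunctional_map_pos`).

Everything is proved (no named facts).  Used by `TaubesCurve.lean` (Taubes's curves, oriented by
`s`) and the reduction of `taubes_canonicalClass_symplecticCurve_four`
(`TaubesCanonicalClassSymplecticCurveFourProofs.lean`).

## References

* C. H. Taubes, The Seiberg–Witten and Gromov invariants, Math. Res. Lett. 2 (1995) 221–238, §3
  (p. 228). [Taubes1995]
* D. McDuff, D. Salamon, Introduction to Symplectic Topology, 3rd ed., OUP (2017), Ex. 4.4.5,
  proof of Thm. 13.3.11, proof of Cor. 13.3.24 (iii). [McDuffSalamon2017]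
* J. M. Lee, Introduction to Smooth Manifolds, 2nd ed. (2013), Thm. 17.31, Thm. 18.14.
  [LeeSmoothManifolds2013]
* A. Hatcher, Algebraic Topology (2002), §2.2 p. 165, §3.3 pp. 234–236. [HatcherAT2002]
* G. E. Bredon, Topology and Geometry, GTM 139 (1993), Thm. V.9.5. [Bredon1993]
-/

noncomputable section

namespace Literature.Geometry.Symplectic

open scoped Manifold ContDiff Topology ContinuousMap
open Set Function
open Literature.Geometry.Kaehler (MForm IsSmoothForm IsClosedForm closedSmoothForms deRhamCohomology)
open Literature.AlgebraicTopology.SingularHomology Literature.NumberTheory.Transcendental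
open Literature.Geometry.Manifold

/-- Local notation: `𝔼 n` is the model space `EuclideanSpace ℝ (Fin n)`. -/
local notation "𝔼" n:arg => EuclideanSpace ℝ (Fin n)

/-- Local notation: `ℛ n` is the model with corners `modelWithCornersSelf ℝ (EuclideanSpace ℝ (Fin n))`
(Mathlib's `𝓡 n`, spelled locally so that the file reads the same as its importers
`TaubesCurve.lean` / `TaubesCanonicalClassSymplecticCurveFourProofs.lean`, where the scoped token
is unavailable). -/
local notation "ℛ" n:arg => modelWithCornersSelf ℝ (EuclideanSpace ℝ (Fin n))

/-! ### The period functional of a closed form -/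

section Period

variable {n : ℕ} {N : Type} [TopologicalSpace N] [ChartedSpace (𝔼 n) N] [IsManifold (ℛ n) ∞ N]
  [T2Space N] [SigmaCompactSpace N] {k : ℕ}

/-- The two spellings of the change of coefficients `ℤ → ℝ` used in the tree agree. [folklore] -/
theorem intCastAddHom_real_eq_algebraMap :
    Int.castAddHom ℝ = (algebraMap ℤ ℝ : ℤ →+* ℝ).toAddMonoidHom :=
  AddMonoidHom.ext fun z ↦ (eq_intCast (algebraMap ℤ ℝ) z).symm

/-- **The period functional of a closed `k`-form** `α` on a manifold `N`: the additive map
`H_k(N; ℤ) → ℝ`, `z ↦ ⟨[α], z ⊗ 1⟩`, pairing the real class of `α` (de Rham's integration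
isomorphism) with the real reduction of an integral class — on the class of a smooth cycle, the
integral of `α` over it.  For the symplectic form of a symplectic manifold this is the symplectic
area `⟨[ω], ·⟩` (McDuff–Salamon 2017, Ex. 4.4.5; Taubes 1995, §3: "the integral of `ω` over `Σ`").
[cite: McDuffSalamon2017, Ex. 4.4.5] [cite: Bredon1993, Thm. V.9.5] -/
def periodFunctional (α : MForm (ℛ n) N ℝ k) (hα : IsSmoothForm α) (hcl : IsClosedForm α) :
    singularHomology ℤ ℤ N k →+ ℝ :=
  (kroneckerPairing ℝ ℝ N k (realClassOfClosedForm α hα hcl)).toAddMonoidHom.comp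
    (singularHomology.coeffChange N (Int.castAddHom ℝ) k)

/-- Unfolding `periodFunctional`: `P_α z = ⟨[α], z ⊗ 1⟩`. [folklore] -/
theorem periodFunctional_apply (α : MForm (ℛ n) N ℝ k) (hα : IsSmoothForm α) (hcl : IsClosedForm α)
    (z : singularHomology ℤ ℤ N k) :
    periodFunctional α hα hcl z =
      kroneckerPairing ℝ ℝ N k (realClassOfClosedForm α hα hcl)
        (singularHomology.coeffChange N (Int.castAddHom ℝ) k z) :=
  rfl

/-- The period functional as a `ℤ`-linear map `H_k(N; ℤ) →ₗ[ℤ] ℝ` (the shape of the area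
functional `A` in `taubes_canonicalClass_symplecticCurve_four`). [folklore] -/
def periodLinearMap (α : MForm (ℛ n) N ℝ k) (hα : IsSmoothForm α) (hcl : IsClosedForm α) :
    singularHomology ℤ ℤ N k →ₗ[ℤ] ℝ where
  toFun := periodFunctional α hα hcl
  map_add' x y := map_add _ x y
  map_smul' c x := by
    -- the `ℤ`-action of the bundled module `Hₖ(N; ℤ)` is the integer multiple (`int_smul_eq_zsmul`)
    have h1 := congrArg (periodFunctional α hα hcl)
      (int_smul_eq_zsmul (singularHomology ℤ ℤ N k).isModule c x)
    rw [map_zsmul] at h1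
    exact h1

/-- `periodLinearMap` is `periodFunctional` on elements. [folklore] -/
@[simp]
theorem periodLinearMap_apply (α : MForm (ℛ n) N ℝ k) (hα : IsSmoothForm α) (hcl : IsClosedForm α)
    (z : singularHomology ℤ ℤ N k) :
    periodLinearMap α hα hcl z = periodFunctional α hα hcl z :=
  rfl

variable {S : Type} [TopologicalSpace S] [T2Space S] [CompactSpace S] [ConnectedSpace S]
  [ChartedSpace (𝔼 k) S] [IsManifold (ℛ k) ∞ S]

omit [ConnectedSpace S] in
/-- **Naturality of periods**: for a `C^∞` map `f : S → N` from a closed `k`-manifold with a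
`ℤ`-orientation `μS`, the period of `α` on `f_* [S]` is the period of `f^* α` on `[S]`,
`⟨[α], f_*[S] ⊗ 1⟩ = ⟨[f^* α], [S] ⊗ 1⟩` (naturality of de Rham's isomorphism, Lee 2013
Thm. 18.14, and of the Kronecker pairing). [cite: LeeSmoothManifolds2013, Thm. 18.14] -/
theorem periodFunctional_map_fundamentalClass {f : S → N} (hf : ContMDiff (ℛ k) (ℛ n) ∞ f)
    (α : MForm (ℛ n) N ℝ k) (hα : IsSmoothForm α) (hcl : IsClosedForm α)
    (μS : HomologicalOrientation ℤ S k) :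
    periodFunctional α hα hcl (singularHomology.map ℤ ℤ ⟨f, hf.continuous⟩ k μS.fundamentalClass) =
      periodFunctional (α.pullback (ℛ k) f) (pullback_mem_closedSmoothForms hf ⟨hα, hcl⟩).1
        (pullback_mem_closedSmoothForms hf ⟨hα, hcl⟩).2 μS.fundamentalClass := by
  haveI : LocallyCompactSpace S := ChartedSpace.locallyCompactSpace (𝔼 k) S
  haveI : SecondCountableTopology S := ChartedSpace.secondCountable_of_sigmaCompact (𝔼 k) S
  haveI : LocallyCompactSpace N := ChartedSpace.locallyCompactSpace (𝔼 n) N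
  haveI : SecondCountableTopology N := ChartedSpace.secondCountable_of_sigmaCompact (𝔼 n) N
  rw [periodFunctional_apply, periodFunctional_apply, singularHomology.coeffChange_map,
    ← kroneckerPairing_map, realClassOfClosedForm_eq, realClassOfClosedForm_eq,
    ← integrationDeRhamIsoFamily_map_of_contMDiff hf k, deRhamCohomology.map_mk]

/-- **A closed form whose pull-back vanishes nowhere has non-zero period on `f_* [S]`**: if
`f^* α` is nowhere zero on the closed connected `k`-manifold `S` then `⟨[α], f_*[S] ⊗ 1⟩ ≠ 0`
for every `ℤ`-orientation of `S` (it is `⟨[f^* α], [S] ⊗ 1⟩`, and a nowhere-vanishing top form is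
not exact; the tree's `kroneckerPairing_integrationDeRham_map_fundamentalClass_ne_zero`).
[cite: McDuffSalamon2017, Ex. 4.4.5] [cite: LeeSmoothManifolds2013, Thm. 17.31] -/
theorem periodFunctional_map_fundamentalClass_ne_zero {f : S → N} (hf : ContMDiff (ℛ k) (ℛ n) ∞ f)
    (α : MForm (ℛ n) N ℝ k) (hα : IsSmoothForm α) (hcl : IsClosedForm α)
    (hne : ∀ y, α.pullback (ℛ k) f y ≠ 0) (μS : HomologicalOrientation ℤ S k) :
    periodFunctional α hα hcl
      (singularHomology.map ℤ ℤ ⟨f, hf.continuous⟩ k μS.fundamentalClass) ≠ 0 := by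
  rw [periodFunctional_apply, singularHomology.coeffChange_map, realClassOfClosedForm_eq,
    intCastAddHom_real_eq_algebraMap]
  exact kroneckerPairing_integrationDeRham_map_fundamentalClass_ne_zero μS hf ⟨α, hα, hcl⟩ hne

omit [ConnectedSpace S] [IsManifold (ℛ k) ∞ S] in
/-- **Reversing the orientation of `S` reverses the period on `f_* [S]`** (`[S]_{-μ} = -[S]_μ`,
Hatcher 2002 §3.3 p. 236). [cite: HatcherAT2002, §3.3 p. 236] -/
theorem periodFunctional_map_fundamentalClass_neg {f : S → N} (hf : Continuous f)
    (α : MForm (ℛ n) N ℝ k) (hα : IsSmoothForm α) (hcl : IsClosedForm α)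
    (μS : HomologicalOrientation ℤ S k) :
    periodFunctional α hα hcl (singularHomology.map ℤ ℤ ⟨f, hf⟩ k (-μS).fundamentalClass) =
      -periodFunctional α hα hcl (singularHomology.map ℤ ℤ ⟨f, hf⟩ k μS.fundamentalClass) := by
  rw [HomologicalOrientation.fundamentalClass_neg_holds (R := ℤ) (X := S) k μS, map_neg, map_neg]

/-- **Exactly one orientation of `S` gives a positive period** (existence): if `f^* α` vanishes
nowhere, some `ℤ`-orientation `μS` of the closed connected orientable `S` has
`0 < ⟨[α], f_*[S]_{μS} ⊗ 1⟩` — the orientation of `S` "induced by `α`" (McDuff–Salamon 2017,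
Ex. 4.4.5: a symplectic submanifold is oriented by `ω`, `∫_Σ ω > 0`). [cite: McDuffSalamon2017, Ex. 4.4.5] -/
theorem exists_periodFunctional_map_fundamentalClass_pos {f : S → N}
    (hf : ContMDiff (ℛ k) (ℛ n) ∞ f) (α : MForm (ℛ n) N ℝ k) (hα : IsSmoothForm α)
    (hcl : IsClosedForm α) (hne : ∀ y, α.pullback (ℛ k) f y ≠ 0)
    (μ₀ : HomologicalOrientation ℤ S k) :
    ∃ μS : HomologicalOrientation ℤ S k, 0 < periodFunctional α hα hcl
      (singularHomology.map ℤ ℤ ⟨f, hf.continuous⟩ k μS.fundamentalClass) := by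
  rcases lt_or_gt_of_ne (periodFunctional_map_fundamentalClass_ne_zero hf α hα hcl hne μ₀) with h | h
  · refine ⟨-μ₀, ?_⟩
    rw [periodFunctional_map_fundamentalClass_neg]
    exact neg_pos.2 h
  · exact ⟨μ₀, h⟩

omit [IsManifold (ℛ k) ∞ S] in
/-- **Exactly one orientation of `S` gives a positive period** (uniqueness): two
`ℤ`-orientations of the closed connected `S` with positive period of `α` on `f_* [S]` coincide
(the orientations of a connected manifold are `ν` and `-ν`, Hatcher 2002 §3.3 p. 234).
[cite: HatcherAT2002, §3.3 p. 234] -/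
theorem eq_of_periodFunctional_map_fundamentalClass_pos {f : S → N} (hf : Continuous f)
    (α : MForm (ℛ n) N ℝ k) (hα : IsSmoothForm α) (hcl : IsClosedForm α)
    {μS νS : HomologicalOrientation ℤ S k}
    (hμ : 0 < periodFunctional α hα hcl (singularHomology.map ℤ ℤ ⟨f, hf⟩ k μS.fundamentalClass))
    (hν : 0 < periodFunctional α hα hcl (singularHomology.map ℤ ℤ ⟨f, hf⟩ k νS.fundamentalClass)) :
    μS = νS := by
  rcases HomologicalOrientation.eq_or_eq_neg_of_connected_holds S μS νS with h | h
  · exact h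
  · subst h
    rw [periodFunctional_map_fundamentalClass_neg] at hμ
    exact absurd hν (not_lt.2 (neg_pos.1 hμ).le)

end Period

/-! ### Symplectic surfaces have non-zero symplectic area -/

section SymplecticArea

variable {N : Type} [TopologicalSpace N] [T2Space N] [ChartedSpace (𝔼 4) N] [IsManifold (ℛ 4) ∞ N]
  [SigmaCompactSpace N]
  {S : Type} [TopologicalSpace S] [CompactSpace S] [ConnectedSpace S] [ChartedSpace (𝔼 2) S]
  [IsManifold (ℛ 2) ∞ S]

/-- **A symplectic surface has non-zero symplectic area, whatever its orientation** (Taubes 1995,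
§3 p. 228: the fundamental class of a pseudo-holomorphic — hence symplectic — submanifold "is a
priori nontrivial in `H₂(X; ℤ)` … since the integral of `ω` over `Σ` is positive"; McDuff–Salamon
2017, Ex. 4.4.5): for a smooth closed `2`-form `s` on a `4`-manifold `N`, a closed connected
surface `S` and a `C^∞` map `b : S → N` along which `s` is non-degenerate on `S`,
`⟨[s], b_*[S]_{μS} ⊗ 1⟩ ≠ 0` for every `ℤ`-orientation `μS`. [cite: Taubes1995, §3 (p. 228)]
[cite: McDuffSalamon2017, Ex. 4.4.5] -/
theorem periodFunctional_map_ne_zero_of_symplecticSurface [T2Space S] (s : MForm (ℛ 4) N ℝ 2)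
    (hs : IsSmoothForm s) (hcl : IsClosedForm s) {b : S → N} (hb : ContMDiff (ℛ 2) (ℛ 4) ∞ b)
    (hnd : ∀ y (v : TangentSpace (ℛ 2) y), v ≠ 0 → ∃ w : TangentSpace (ℛ 2) y,
      s (b y) ![mfderiv (ℛ 2) (ℛ 4) b y v, mfderiv (ℛ 2) (ℛ 4) b y w] ≠ 0)
    (μS : HomologicalOrientation ℤ S 2) :
    periodFunctional s hs hcl (singularHomology.map ℤ ℤ ⟨b, hb.continuous⟩ 2 μS.fundamentalClass) ≠ 0 :=
  periodFunctional_map_fundamentalClass_ne_zero hb s hs hcl (symplecticSurface_pullback_ne_zero s b hnd) μS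

/-- **The orientation of a symplectic surface induced by the symplectic form exists**: some
`ℤ`-orientation `μS` of `S` has positive symplectic area `0 < ⟨[s], b_*[S]_{μS} ⊗ 1⟩`
(Taubes 1995, §3 p. 228: "the restriction of the symplectic form … orients `Σ`"; McDuff–Salamon
2017, Ex. 4.4.5).  (`S` is orientable: the tree's `symplecticSurfaceOrientation` is one
orientation; it or its reverse has positive area.) [cite: Taubes1995, §3 (p. 228)]
[cite: McDuffSalamon2017, Ex. 4.4.5] -/
theorem exists_periodFunctional_map_pos_of_symplecticSurface [T2Space S] (s : MForm (ℛ 4) N ℝ 2)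
    (hs : IsSmoothForm s) (hcl : IsClosedForm s) {b : S → N} (hb : ContMDiff (ℛ 2) (ℛ 4) ∞ b)
    (hnd : ∀ y (v : TangentSpace (ℛ 2) y), v ≠ 0 → ∃ w : TangentSpace (ℛ 2) y,
      s (b y) ![mfderiv (ℛ 2) (ℛ 4) b y v, mfderiv (ℛ 2) (ℛ 4) b y w] ≠ 0) :
    ∃ μS : HomologicalOrientation ℤ S 2, 0 < periodFunctional s hs hcl
      (singularHomology.map ℤ ℤ ⟨b, hb.continuous⟩ 2 μS.fundamentalClass) :=
  exists_periodFunctional_map_fundamentalClass_pos hb s hs hcl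
    (symplecticSurface_pullback_ne_zero s b hnd) (symplecticSurfaceOrientation s hs b hb hnd)

/-- The same for a smooth EMBEDDING `b` of a surface not assumed Hausdorff (it is, as a subspace
of `N`) — the binders of `taubes_canonicalClass_symplecticCurve_four` (iii).
[cite: Taubes1995, §3 (p. 228)] -/
theorem exists_periodFunctional_map_pos_of_isSmoothEmbedding (s : MForm (ℛ 4) N ℝ 2)
    (hs : IsSmoothForm s) (hcl : IsClosedForm s) {b : S → N}
    (hb : Manifold.IsSmoothEmbedding (ℛ 2) (ℛ 4) ∞ b)
    (hnd : ∀ y (v : TangentSpace (ℛ 2) y), v ≠ 0 → ∃ w : TangentSpace (ℛ 2) y,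
      s (b y) ![mfderiv (ℛ 2) (ℛ 4) b y v, mfderiv (ℛ 2) (ℛ 4) b y w] ≠ 0) :
    ∃ μS : HomologicalOrientation ℤ S 2, 0 < periodFunctional s hs hcl
      (singularHomology.map ℤ ℤ ⟨b, hb.isEmbedding.continuous⟩ 2 μS.fundamentalClass) := by
  haveI : T2Space S := hb.isEmbedding.t2Space
  exact exists_periodFunctional_map_pos_of_symplecticSurface s hs hcl hb.contMDiff hnd

omit [IsManifold (ℛ 2) ∞ S] in
/-- **Positive symplectic area pins the orientation of a symplectic surface**: two
`ℤ`-orientations of the connected `S` with `0 < ⟨[s], b_*[S] ⊗ 1⟩` are equal. [cite: HatcherAT2002, §3.3 p. 234] -/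
theorem eq_of_periodFunctional_map_pos (s : MForm (ℛ 4) N ℝ 2) (hs : IsSmoothForm s)
    (hcl : IsClosedForm s) {b : S → N} (hb : Manifold.IsSmoothEmbedding (ℛ 2) (ℛ 4) ∞ b)
    {μS νS : HomologicalOrientation ℤ S 2}
    (hμ : 0 < periodFunctional s hs hcl
      (singularHomology.map ℤ ℤ ⟨b, hb.isEmbedding.continuous⟩ 2 μS.fundamentalClass))
    (hν : 0 < periodFunctional s hs hcl
      (singularHomology.map ℤ ℤ ⟨b, hb.isEmbedding.continuous⟩ 2 νS.fundamentalClass)) :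
    μS = νS :=
  haveI : T2Space S := hb.isEmbedding.t2Space
  eq_of_periodFunctional_map_fundamentalClass_pos hb.isEmbedding.continuous s hs hcl hμ hν

end SymplecticArea

end Literature.Geometry.Symplectic

end
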